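import Summits.CriticalPhenomena.Ising3D.TaylorCertificateTermwise
import Mathlib.Tactic.Linarith
import Mathlib.Tactic.Positivity
import Mathlib.Tactic.Ring
import HarnessLib

/-!
# The dominated termwise rule for the odd sector of a derivative-functional certificate
(cell `pub-ising3x`, seat boot-1; the (β)-style sufficient condition for `oddTermValue ≥ 0`, i.e. what a
γ-certificate can check term by term WITHOUT the L-odd-tail lemma (g1))

HONEST FRAMING: lottery ticket; floor = tightest certified 3D Ising CFT bounds; no exact-solution
claim without a proof.

`oddTermValue α Δσ Δε Δ ℓ (n,j) = (-1)^ℓ c₋ φ₃ + c₊ (φ₄ - φ₅)` with the SIGNED `⟨σεσε⟩` coefficient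
`c₋ = A_{n,j}(-t/2,t/2)/λ_ℓ`, the non-negative `⟨εσσε⟩` one `c₊ = A_{n,j}(t/2,t/2)/λ_ℓ` (`t = Δσ-Δε`) and
`φ₃ = α³[F^s_-[𝒫_{Δ+n,j}]]`, `φ₄ - φ₅ = α⁴[F^{Δσ}_-[𝒫]] - α⁵[F^{Δσ}_+[𝒫]]`. Two sufficient conditions:
* `oddTermValue_nonneg_of_dominated` — `c₊ (φ₄ - φ₅) ≥ |c₋| |φ₃|`;
* `oddTermValue_nonneg_of_dominated'` — `c₊ (φ₄ - φ₅) ≥ ((c₊ + c̄)/2) |φ₃|` with `c̄ = A_{n,j}(-t/2,-t/2)/λ_ℓ`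
  (the conjugate family), using the tree's coefficient-level Cauchy–Schwarz `abs_hrCoeffAB_neg_le` —
  all three coefficient families are then NON-NEGATIVE closed forms, so the condition is a region
  inequality in `(E, j)` of the same kind as the even sector's.
These are exactly as strong as the point-functional class's dominated odd tail (`MixedOddTail`): weak
near the leading odd twist, where (g1) is needed. Sources: Dolan–Osborn 2004 §3 eq. (3.11) (as typed).
-/

namespace Summit.CriticalPhenomena.Ising3D

open Finset Set
open Literature.MathematicalPhysics.QuantumFieldTheory.ConformalBootstrap3D

/-- **Dominated odd termwise rule.** If `c₊ (φ₄ - φ₅) ≥ |c₋|·|φ₃|` at `(n,j)` then `oddTermValue ≥ 0`.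
[folklore] -/
theorem oddTermValue_nonneg_of_dominated (α : CrossingFunctional) (Δσ Δε Δ : ℝ) (ℓ : ℕ)
    (q : ℕ × ℕ)
    (h : |hrCoeffAB (-(Δσ - Δε) / 2) ((Δσ - Δε) / 2) Δ ℓ q.1 q.2 / legendreLam ℓ| *
        |α.α₃ (crossF ((Δσ + Δε) / 2) (-1) (zMono (Δ + (q.1 : ℝ)) q.2))| ≤
      hrCoeffAB ((Δσ - Δε) / 2) ((Δσ - Δε) / 2) Δ ℓ q.1 q.2 / legendreLam ℓ *
        (α.α₄ (crossF Δσ (-1) (zMono (Δ + (q.1 : ℝ)) q.2)) -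
          α.α₅ (crossF Δσ 1 (zMono (Δ + (q.1 : ℝ)) q.2)))) :
    0 ≤ oddTermValue α Δσ Δε Δ ℓ q := by
  unfold oddTermValue
  set c := hrCoeffAB (-(Δσ - Δε) / 2) ((Δσ - Δε) / 2) Δ ℓ q.1 q.2 / legendreLam ℓ
  set φ := α.α₃ (crossF ((Δσ + Δε) / 2) (-1) (zMono (Δ + (q.1 : ℝ)) q.2))
  have h1 : -(|c| * |φ|) ≤ (-1 : ℝ) ^ ℓ * c * φ := by
    have : |(-1 : ℝ) ^ ℓ * c * φ| = |c| * |φ| := by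
      rw [abs_mul, abs_mul, abs_pow, abs_neg, abs_one, one_pow, one_mul]
    have := neg_abs_le ((-1 : ℝ) ^ ℓ * c * φ)
    linarith
  linarith

/-- **Dominated odd termwise rule with the conjugate family** (strictly above the bound, `Δ ≠ 1` if
`ℓ = 0`): if `c₊ (φ₄ - φ₅) ≥ ((c₊ + c̄)/2)·|φ₃|` then `oddTermValue ≥ 0`. [cite: DolanOsborn2004, §3 eq. (3.11)] -/
theorem oddTermValue_nonneg_of_dominated' (α : CrossingFunctional) (Δσ Δε Δ : ℝ) {ℓ : ℕ}
    (hΔ : unitarityBound3D ℓ < Δ) (h1 : ℓ = 0 → Δ ≠ 1) (q : ℕ × ℕ)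
    (h : (hrCoeffAB ((Δσ - Δε) / 2) ((Δσ - Δε) / 2) Δ ℓ q.1 q.2 / legendreLam ℓ +
          hrCoeffAB (-(Δσ - Δε) / 2) (-(Δσ - Δε) / 2) Δ ℓ q.1 q.2 / legendreLam ℓ) / 2 *
        |α.α₃ (crossF ((Δσ + Δε) / 2) (-1) (zMono (Δ + (q.1 : ℝ)) q.2))| ≤
      hrCoeffAB ((Δσ - Δε) / 2) ((Δσ - Δε) / 2) Δ ℓ q.1 q.2 / legendreLam ℓ *
        (α.α₄ (crossF Δσ (-1) (zMono (Δ + (q.1 : ℝ)) q.2)) -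
          α.α₅ (crossF Δσ 1 (zMono (Δ + (q.1 : ℝ)) q.2)))) :
    0 ≤ oddTermValue α Δσ Δε Δ ℓ q := by
  refine oddTermValue_nonneg_of_dominated α Δσ Δε Δ ℓ q (le_trans ?_ h)
  have hlam := legendreLam_pos ℓ
  have hb := abs_hrCoeffAB_neg_le (a := -(Δσ - Δε) / 2) hΔ h1 q.1 q.2
  rw [show -(-(Δσ - Δε) / 2) = (Δσ - Δε) / 2 by ring] at hb
  refine mul_le_mul_of_nonneg_right ?_ (abs_nonneg _)
  rw [abs_div, abs_of_pos hlam,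
    show (hrCoeffAB ((Δσ - Δε) / 2) ((Δσ - Δε) / 2) Δ ℓ q.1 q.2 / legendreLam ℓ +
        hrCoeffAB (-(Δσ - Δε) / 2) (-(Δσ - Δε) / 2) Δ ℓ q.1 q.2 / legendreLam ℓ) / 2 =
      (hrCoeffAB ((Δσ - Δε) / 2) ((Δσ - Δε) / 2) Δ ℓ q.1 q.2 +
        hrCoeffAB (-(Δσ - Δε) / 2) (-(Δσ - Δε) / 2) Δ ℓ q.1 q.2) / 2 / legendreLam ℓ by ring]
  rw [add_comm] at hb
  exact div_le_div_of_nonneg_right hb hlam.le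

end Summit.CriticalPhenomena.Ising3D
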